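import Summits.KontsevichZagierPeriods.Zeta5Search.WellPoisedFaceTailWindows
import Summits.KontsevichZagierPeriods.Zeta5Search.WellPoisedFacePhi
import HarnessLib

/-!
# Well-poised face forms with `B` tail bricks — Lemma 19 COMPLETE:
# `Λ_n = D_{M₁}³ D_{M₂} ⋯ D_{M_B} · Φ(h_n)⁻¹ · F(h_n) ∈ ℤ + ℤζ(5) + ℤζ(7) + ⋯ + ℤζ(B+1)`

pub-zeta5 · fam-vwp generation 8, file 10.  HONEST FRAMING: systematic search; no irrationality claim unless
certified.  Nothing here is evidence about any `ζ(s)`: the forms `Λ_n` tend to `+∞`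
(`WellPoisedFaceOddGrowthFree.faceLambda_faceForm_tendsto_atTop`), so their integrality proves nothing.

`WellPoisedFaceTailWindows` (file 9) proved `D(n) · F(h_n) ∈ ℤ + Σ_{s odd, 5≤s≤M+3} ℤζ(s)` for an integral face
direction `E : IntFaceDir M` with sorted tails, `D(n) = D_{M₁}³D_{M₂}⋯D_{M_{M+2}} = E.faceD n`.  This file
removes Zudilin's arithmetic factor `Φ(h_n) = ∏_{√h₀ < p ≤ M_{q−3}} p^{ν_p}` [Zudilin2004, (8.9)] (`E.facePhi n`,
fam-odd's verbatim typing `PhiQ` of (8.9) with `r = 3`, heads `h₁ = h₂ = h₃ = 1`, `M + 2` tail bricks):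

* `IntFaceDir.faceLambda_tailF_mem` — for every integral face direction with SORTED tails, `M ≥ 1` even, and
  every `n` with `(M+1)² ≤ η₀ n + 2`: `Λ_n = E.faceLambda (tailF E.η₀ E.tail) n ∈ ℤ + Σ_{s odd, 5≤s≤M+3} ℤζ(s)`
  ([Zudilin2004, Lemma 19] for the `q = M + 5` box on the face, kernel-checked; fam-odd's
  `faceLambda_tailF_mem_ratSpan` is the `ℚ`-span version, fam-vwp 8's `faceLambda_mem` the case `q = 7`).

The restriction `(M+1)² ≤ η₀ n + 2` (so that every prime `p > √h₀` of `Φ` is `≥ M + 2 = J`) comes from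
fam-indep's port of [Zudilin2004, Lemmas 17–18] (`lai_pf_padicOrdGe`, stated for primes `p ≥ J`); it excludes
finitely many `n` per direction and is irrelevant for `Λ_n → ∞`.

## Method (prime by prime, [Zudilin2004, (8.11)]; verbatim port of fam-vwp 8 with `Fin 4 ↦ Fin (M+2)`)
For a prime `p` of `Φ` (`√h₀ < p ≤ M_{q−3}`, hence `η₀ n < p²`, `p ≥ M + 2`): `ord_p D(n) = M + 4` (each `D_{M_i}`
once); `ord_p ĉ_{o,k} ≥ φ̃(k) − (M+1−o)` with `φ̃(k) =` Lai's `laiPhiDiv (M+2) 0 η₀ n η k p` (`lai_pf_padicOrdGe`),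
and `ν_p = min_k ν_{k,p} ≤ ν_{k+1,p} = φ̃(k)` (`nuKPq_face_eq_laiPhiDiv`: on the face the three pair summands of
(8.9) vanish and the brick summands are Lai's); `ord_p H_k^{(o+3)} ≥ −(o+3)` (`k < p²`).  Hence
`ord_p(D·A_o) ≥ ν_p` and `ord_p(D·A₀) ≥ ν_p`; with `D·A_o, D·A₀ ∈ ℤ` (file 9) this gives `D·A_o/Φ, D·A₀/Φ ∈ ℤ`
(`Rat.exists_int_of_padicOrdGe`).
-/

noncomputable section

open Finset Filter Polynomial

namespace Summit.KontsevichZagierPeriods.Zeta5Search.WellPoisedFace.IntFaceDir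

open Literature.NumberTheory.Transcendental
open Literature.NumberTheory.Transcendental.BallRivoal (IsInt harm)
open Summit.KontsevichZagierPeriods.Zeta5Search.WellPoisedFaceRate (tailF etaB etaB_fin etaB_of_lt etaB_mono
  tailCoef tailConst laiTailData exists_laiTailData tailDataOf tailRQ_eq_pfEval tailData_window
  tailF_eq_coef tail_sum_order_zero tail_sum_vanish tri_int brickTerm_shift sum_oddWindow_eq)

variable {M : ℕ} (E : IntFaceDir M) (n : ℕ)

/-! ## 1. `Φ(h_n)` as a product of prime powers -/

/-- Zudilin's exponent `ν_p` [(8.9)] at the face parameters (`M + 2` tail bricks, `k_lo = h₄`). -/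
def faceNu (p : ℕ) : ℤ := nuPq (E.h0 n) 1 1 1 (E.hT n) (E.hT n 0) p

/-- The primes of `Φ(h_n)`: `√h₀ < p ≤ M_{q−3}` (the exponent of the largest tail). -/
def facePhiPrimes : Finset ℕ :=
  (Ioc (Nat.sqrt (E.h0 n).toNat) (E.faceMZ n (Fin.last (M + 1))).toNat).filter Nat.Prime

/-- `Φ(h_n) = ∏_{p ∈ facePhiPrimes} p^{ν_p}` (definitional). -/
theorem facePhi_eq_prod : E.facePhi n = ∏ p ∈ E.facePhiPrimes n, p ^ (E.faceNu n p).toNat := rfl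

/-- `ord_p Φ(h_n) = ν_p` for the primes of `Φ`, `= 0` otherwise. -/
theorem padicValNat_facePhi (p : ℕ) [hp : Fact p.Prime] :
    padicValNat p (E.facePhi n) = if p ∈ E.facePhiPrimes n then (E.faceNu n p).toNat else 0 := by
  rw [facePhi_eq_prod]
  exact Zudilin2004.padicValNat_prod_prime_pow _ (fun q hq => (mem_filter.1 hq).2) _

/-- `ν_p ≥ 0`. -/
theorem faceNu_nonneg (p : ℕ) (hp : 0 < p) : 0 ≤ E.faceNu n p := by
  unfold faceNu nuPq
  split_ifs with h
  · exact Finset.le_inf' _ _ fun k _ => nuKPq_nonneg _ _ _ _ _ k (by exact_mod_cast hp)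
  · exact le_rfl

/-- A prime of `Φ(h_n)`: `p` prime, `h₀ = η₀ n + 2 < p²`, `p ≤ M_{q−3} = μ(η_q) · n`. -/
theorem mem_facePhiPrimes {p : ℕ} (hp : p ∈ E.facePhiPrimes n) :
    p.Prime ∧ E.η₀ * n + 2 < p ^ 2 ∧ p ≤ E.mu (E.tail (Fin.last (M + 1))) * n := by
  simp only [facePhiPrimes, mem_filter, mem_Ioc, faceMZ_toNat, IntFaceDir.h0, Int.toNat_natCast] at hp
  exact ⟨hp.2, Nat.sqrt_lt'.1 hp.1.1, hp.1.2⟩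

/-! ## 2. `ν_{k+1,p}` on the face is Lai's `φ̃(k)` -/

/-- **`ν_{k+1,p}(h_n) = φ̃(k)`**: Zudilin's exponent (8.9) at the face parameters (`r = 3` with
`h₁ = h₂ = h₃ = 1`: the pair summands vanish, `pairTerm_one`) is Lai's `laiPhiDiv (M+2) 0 η₀ n η k p`
(pole index `k` of the frame `(t+1)_{η₀n+1}` ↔ Zudilin's pole `t = −(k+1)`). -/
theorem nuKPq_face_eq_laiPhiDiv (k p : ℕ) :
    nuKPq (E.h0 n) 1 1 1 (E.hT n) ((k : ℤ) + 1) p = laiPhiDiv (M + 2) 0 E.η₀ n E.tail k p := by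
  have hb : ∀ j : Fin (M + 2), brickTerm (E.h0 n) (E.hT n j) ((k : ℤ) + 1) p
      = ((((E.η₀ - 2 * E.tail j) * n : ℕ) : ℤ)) / p - ((k : ℤ) - ((E.tail j * n : ℕ) : ℤ)) / p
        - (((((E.η₀ - E.tail j) * n : ℕ) : ℤ)) - k) / p := by
    intro j
    have hj := E.two_tail_le j
    have e1 : (((E.η₀ - 2 * E.tail j) * n : ℕ) : ℤ) = (E.η₀ : ℤ) * n - 2 * ((E.tail j : ℤ) * n) := by
      rw [Nat.cast_mul, Nat.cast_sub hj]; push_cast; ring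
    have e2 : (((E.η₀ - E.tail j) * n : ℕ) : ℤ) = (E.η₀ : ℤ) * n - (E.tail j : ℤ) * n := by
      rw [Nat.cast_mul, Nat.cast_sub (E.tail_lt_η₀ j).le]; ring
    rw [brickTerm_shift (E.h0 n) (E.hT n j) k p ((E.η₀ : ℤ) * n) ((E.tail j : ℤ) * n)
      (by unfold IntFaceDir.h0; push_cast; ring) (by unfold IntFaceDir.hT; push_cast; ring), e1, e2, Nat.cast_mul]
  simp only [nuKPq, pairTerm_one, zero_add, hb, laiPhiDiv, Nat.cast_zero, zero_mul, mul_zero, add_zero, sub_zero]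
  ring

/-- **`ν_p ≤ φ̃(k)`** for every pole index `k` of the big window `[η₄ n, (η₀ − η₄) n]`. -/
theorem faceNu_le_laiPhiDiv (p : ℕ) {k : ℕ} (hk₁ : E.tail 0 * n ≤ k) (hk₂ : k ≤ (E.η₀ - E.tail 0) * n) :
    E.faceNu n p ≤ laiPhiDiv (M + 2) 0 E.η₀ n E.tail k p := by
  have hsub : (((E.η₀ - E.tail 0) * n : ℕ) : ℤ) = (E.η₀ : ℤ) * n - (E.tail 0 : ℤ) * n := by
    rw [Nat.cast_mul, Nat.cast_sub (E.tail_lt_η₀ 0).le]; ring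
  have hk₂' : (k : ℤ) ≤ (E.η₀ : ℤ) * n - (E.tail 0 : ℤ) * n := by rw [← hsub]; exact_mod_cast hk₂
  have hk₁' : (E.tail 0 : ℤ) * n ≤ k := by exact_mod_cast hk₁
  have hmem : ((k : ℤ) + 1) ∈ Icc (E.hT n 0) (E.h0 n - E.hT n 0) := by
    simp only [mem_Icc, IntFaceDir.hT, IntFaceDir.h0]; push_cast; constructor <;> linarith
  have h4 : E.hT n 0 ≤ E.h0 n - E.hT n 0 := (mem_Icc.1 hmem).1.trans (mem_Icc.1 hmem).2
  unfold faceNu nuPq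
  rw [dif_pos h4]
  exact (Finset.inf'_le _ hmem).trans (E.nuKPq_face_eq_laiPhiDiv n k p).le

/-! ## 3. `p`-adic orders at the primes of `Φ` -/

/-- `ord_p D(n) ≥ M + 4` for `p ≤ M_{q−3} ≤ M_i ≤ η₀ n < p²` (each `ord_p D_{M_i} = 1`). -/
theorem padicOrdGe_facePi {p : ℕ} [hp : Fact p.Prime] (hp1 : p ≤ E.mu (E.tail (Fin.last (M + 1))) * n)
    (hp2 : E.η₀ * n < p ^ 2) : PadicOrdGe p ((M + 4 : ℕ) : ℤ) ((E.facePi n : ℕ) : ℚ) := by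
  have hj : ∀ i ∈ range (M + 4), PadicOrdGe p 1 ((E.dSlot n i : ℕ) : ℚ) := fun i hi => by
    refine Or.inr (le_of_eq ?_)
    rw [padicValRat.of_nat]
    have hle : etaB E.tail (i - 2) ≤ E.tail (Fin.last (M + 1)) := by
      rw [etaB_of_lt E.tail (i - 2) (by have := mem_range.1 hi; omega)]; exact E.hhi _
    have h1 : p ≤ E.mu (etaB E.tail (i - 2)) * n := hp1.trans (Nat.mul_le_mul_right n (by
      unfold IntFaceDir.mu; exact max_le_max le_rfl (Nat.sub_le_sub_left hle E.η₀)))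
    have h2 : E.mu (etaB E.tail (i - 2)) * n < p ^ 2 := lt_of_le_of_lt (Nat.mul_le_mul_right n (by
      unfold IntFaceDir.mu; exact max_le (Nat.sub_le _ _) (Nat.sub_le _ _))) hp2
    unfold dSlot
    rw [Zudilin2004.padicValNat_lcmUpto_eq_one h1 h2]
    simp
  have h := PadicOrdGe.prod hj
  rw [facePi, Nat.cast_prod]
  simpa using h

/-- Common hypotheses of the Lai lemmas on an integral face direction. -/
theorem tail_hyps : (∀ j, 2 * E.tail j ≤ E.η₀) ∧ 0 < E.η₀ ∧ (∀ j, etaB E.tail 0 ≤ E.tail j)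
    ∧ 2 * etaB E.tail 0 < E.η₀ ∧ etaB E.tail 0 = E.tail 0 := by
  have e0 : etaB E.tail 0 = E.tail 0 := by simpa using etaB_fin E.tail 0
  refine ⟨E.two_tail_le, by have := E.hd; omega, fun j => ?_, by rw [e0]; exact E.two_tail_lt 0, e0⟩
  rw [e0]; exact E.hlo j

/-- `ĉ_{o,k} = 0` beyond the frame. -/
theorem tailDataOf_eq_zero_of_lt (c : ℕ → ℕ → ℚ) {o k : ℕ} (h : E.η₀ * n < k) :
    tailDataOf E.η₀ E.tail n c o k = 0 := by
  simp [tailDataOf, not_le.2 h]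

/-- **(8.11) on the face: `ord_p ĉ_{o,k} ≥ ν_p − (M + 1 − o)`** for a prime `p ≥ M + 2` with `η₀ n < p²`
(`lai_pf_padicOrdGe`: `ord_p ĉ_{o,k} ≥ φ̃(k) − (M+1−o)` on the window, and `ν_p ≤ φ̃(k)`). -/
theorem padicOrdGe_tailData (hs : Monotone E.tail) {c : ℕ → ℕ → ℚ} (hc : c ∈ laiTailData E.η₀ E.tail n)
    {p : ℕ} [hp : Fact p.Prime] (hJp : M + 2 ≤ p) (hp2 : E.η₀ * n < p ^ 2) {o : ℕ} (ho : o < M + 2) (k : ℕ) :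
    PadicOrdGe p (E.faceNu n p - ((M + 1 - o : ℕ) : ℤ)) (tailDataOf E.η₀ E.tail n c o k) := by
  obtain ⟨hδ, hM, hmin, h2, e0⟩ := E.tail_hyps
  by_cases hz : tailDataOf E.η₀ E.tail n c o k = 0
  · rw [hz]; exact PadicOrdGe.zero _
  obtain ⟨hlo, hhi⟩ := tailData_window E.η₀ E.tail n hs E.two_tail_lt hc ho hz
  have hmono := etaB_mono E.tail hs (Nat.zero_le o) ho
  have hk₁ : etaB E.tail 0 * n ≤ k := (Nat.mul_le_mul_right n hmono).trans hlo
  have hk₂ : k ≤ (E.η₀ - etaB E.tail 0) * n :=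
    hhi.trans (Nat.mul_le_mul_right n (Nat.sub_le_sub_left hmono E.η₀))
  have hkM : k ≤ E.η₀ * n := hk₂.trans (Nat.mul_le_mul_right n (Nat.sub_le _ _))
  have hval : tailDataOf E.η₀ E.tail n c o k = laiC (M + 2) 0 E.η₀ n E.tail * c o k := by
    simp only [tailDataOf, if_pos (And.intro ho hkM)]
  have h1 := lai_pf_padicOrdGe (M + 2) 0 E.η₀ n E.tail hδ hM hc (etaB E.tail 0) hmin h2 hJp hp2 hk₁ hk₂
    (s := o + 1) (by omega) (by omega)
  rw [Nat.add_sub_cancel] at h1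
  rw [e0] at hk₁ hk₂
  have hν := E.faceNu_le_laiPhiDiv n p hk₁ hk₂
  rw [hval]
  exact h1.mono (by omega)

/-- **One term of `A₀`**: `ord_p (ĉ_{o,k} · H_k^{(o+3)}) ≥ ν_p − (M + 4)` (`ord_p H_k^{(o+3)} ≥ −(o+3)` as
`k ≤ η₀ n < p²`). -/
theorem padicOrdGe_term (hs : Monotone E.tail) {c : ℕ → ℕ → ℚ} (hc : c ∈ laiTailData E.η₀ E.tail n)
    {p : ℕ} [hp : Fact p.Prime] (hJp : M + 2 ≤ p) (hp2 : E.η₀ * n < p ^ 2) {o : ℕ} (ho : o < M + 2) (k : ℕ) :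
    PadicOrdGe p (E.faceNu n p - ((M + 4 : ℕ) : ℤ)) (tailDataOf E.η₀ E.tail n c o k * harm (o + 3) k) := by
  by_cases hkM : E.η₀ * n < k
  · rw [E.tailDataOf_eq_zero_of_lt n c hkM, zero_mul]; exact PadicOrdGe.zero _
  have h1 := E.padicOrdGe_tailData n hs hc hJp hp2 ho k
  have h3' := padicOrdGe_harm (p := p) (o + 3) k
  have hlog : padicValNat p (Nat.lcmUpto k) ≤ 1 :=
    Zudilin2004.padicValNat_lcmUpto_le_one (lt_of_le_of_lt (not_lt.1 hkM) hp2)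
  have hcast : (((o + 3) * padicValNat p (Nat.lcmUpto k) : ℕ) : ℤ) ≤ ((o + 3 : ℕ) : ℤ) := by
    exact_mod_cast (Nat.mul_le_mul_left (o + 3) hlog).trans (by simp)
  exact (h1.mul h3').mono (by push_cast at hcast ⊢; omega)

/-- For a prime of `Φ(h_n)` with `(M+1)² ≤ η₀ n + 2`: `p ≥ M + 2`, `η₀ n < p²`, `p ≤ M_{q−3}`. -/
theorem facePhiPrimes_bounds (hn : (M + 1) ^ 2 ≤ E.η₀ * n + 2) {p : ℕ} (hp : p ∈ E.facePhiPrimes n) :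
    M + 2 ≤ p ∧ E.η₀ * n < p ^ 2 ∧ p ≤ E.mu (E.tail (Fin.last (M + 1))) * n := by
  obtain ⟨-, h2, h3⟩ := E.mem_facePhiPrimes n hp
  refine ⟨?_, by omega, h3⟩
  by_contra h
  have : p ^ 2 ≤ (M + 1) ^ 2 := Nat.pow_le_pow_left (by omega) 2
  omega

/-- **`ord_p (D·A_o) ≥ ν_p`** at every prime of `Φ(h_n)` (`A_o = binom(o+2,2) Σ_k ĉ_{o,k}`; in fact
`≥ ν_p + o + 3`). -/
theorem padicOrdGe_facePi_tailCoef (hs : Monotone E.tail) (hn : (M + 1) ^ 2 ≤ E.η₀ * n + 2)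
    {c : ℕ → ℕ → ℚ} (hc : c ∈ laiTailData E.η₀ E.tail n) {p : ℕ} (hpS : p ∈ E.facePhiPrimes n) (o : ℕ) :
    PadicOrdGe p (E.faceNu n p)
      (((E.facePi n : ℕ) : ℚ) * tailCoef (E.η₀ * n) (tailDataOf E.η₀ E.tail n c) o) := by
  by_cases ho : o < M + 2
  swap
  · have hz : tailCoef (E.η₀ * n) (tailDataOf E.η₀ E.tail n c) o = 0 := by
      rw [tailCoef, sum_eq_zero fun k _ => ?_, mul_zero]
      simp [tailDataOf, ho]
    rw [hz, mul_zero]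
    exact PadicOrdGe.zero _
  obtain ⟨hJp, hp2, hp1⟩ := E.facePhiPrimes_bounds n hn hpS
  haveI := Fact.mk (E.mem_facePhiPrimes n hpS).1
  have hPi := E.padicOrdGe_facePi n hp1 hp2
  have hS : PadicOrdGe p (E.faceNu n p - ((M + 1 - o : ℕ) : ℤ))
      (∑ k ∈ range (E.η₀ * n + 1), tailDataOf E.η₀ E.tail n c o k) :=
    PadicOrdGe.sum fun k _ => E.padicOrdGe_tailData n hs hc hJp hp2 ho k
  obtain ⟨m, hm⟩ := tri_int o
  have ht : PadicOrdGe p 0 (((o : ℚ) + 1) * ((o : ℚ) + 2) / 2) := by rw [hm]; exact PadicOrdGe.of_int m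
  rw [tailCoef]
  exact (hPi.mul (ht.mul hS)).mono (by push_cast; omega)

/-- **`ord_p (D·A₀) ≥ ν_p`** at every prime of `Φ(h_n)`. -/
theorem padicOrdGe_facePi_tailConst (hs : Monotone E.tail) (hn : (M + 1) ^ 2 ≤ E.η₀ * n + 2)
    {c : ℕ → ℕ → ℚ} (hc : c ∈ laiTailData E.η₀ E.tail n) {p : ℕ} (hpS : p ∈ E.facePhiPrimes n) :
    PadicOrdGe p (E.faceNu n p)
      (((E.facePi n : ℕ) : ℚ) * tailConst (E.η₀ * n) (M + 2) (tailDataOf E.η₀ E.tail n c)) := by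
  obtain ⟨hJp, hp2, hp1⟩ := E.facePhiPrimes_bounds n hn hpS
  haveI := Fact.mk (E.mem_facePhiPrimes n hpS).1
  have hPi := E.padicOrdGe_facePi n hp1 hp2
  have hS : PadicOrdGe p (E.faceNu n p - ((M + 4 : ℕ) : ℤ))
      (tailConst (E.η₀ * n) (M + 2) (tailDataOf E.η₀ E.tail n c)) := by
    rw [tailConst]
    refine PadicOrdGe.sum fun k _ => PadicOrdGe.sum fun o ho => ?_
    obtain ⟨m, hm⟩ := tri_int o
    have ht : PadicOrdGe p 0 (((o : ℚ) + 1) * ((o : ℚ) + 2) / 2) := by rw [hm]; exact PadicOrdGe.of_int m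
    exact (ht.mul (E.padicOrdGe_term n hs hc hJp hp2 (mem_range.1 ho) k)).mono (by omega)
  exact (hPi.mul hS).mono (by push_cast; omega)

/-! ## 4. Division by `Φ(h_n)` and the theorem -/

/-- An integer `x` with `ord_p x ≥ ν_p` at every prime of `Φ(h_n)` is divisible by `Φ(h_n)`. -/
theorem exists_int_div_facePhi {x : ℚ} (hx : ∃ z : ℤ, x = (z : ℚ))
    (hord : ∀ p ∈ E.facePhiPrimes n, PadicOrdGe p (E.faceNu n p) x) :
    ∃ z : ℤ, x / (E.facePhi n : ℚ) = (z : ℚ) := by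
  obtain ⟨z, rfl⟩ := hx
  refine Rat.exists_int_of_padicOrdGe fun p hp => ?_
  haveI := Fact.mk hp
  rw [div_eq_mul_inv]
  have hv := E.padicValNat_facePhi n p
  have hinv := Zudilin2004.padicOrdGe_inv_natCast (p := p) (E.facePhi n)
  by_cases hP : p ∈ E.facePhiPrimes n
  · rw [if_pos hP] at hv
    rw [hv, Int.toNat_of_nonneg (E.faceNu_nonneg n p hp.pos)] at hinv
    simpa using ((hord p hP).mul hinv)
  · rw [if_neg hP] at hv
    rw [hv] at hinv
    simpa using (PadicOrdGe.of_int z).mul hinv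

/-- **THEOREM ([Zudilin2004, Lemma 19] on a `B`-brick face, kernel).**  For every integral face direction
`E : IntFaceDir M` (`q = M + 5`) with SORTED tails, `M ≥ 1` even, and every `n` with `(M+1)² ≤ η₀ n + 2`, the
normalised face form `Λ_n = D(n) · Φ(h_n)⁻¹ · F(h_n)` (`E.faceLambda (tailF E.η₀ E.tail) n`, the growing forms of
`WellPoisedFaceOddGrowthFree`) lies in `ℤ + ℤζ(5) + ℤζ(7) + ⋯ + ℤζ(M+3)`.  (The forms tend to `+∞`; this is NOT
evidence about any of these numbers.) -/
theorem faceLambda_tailF_mem (hs : Monotone E.tail) (hM1 : 1 ≤ M) (hMe : Even M)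
    (hn : (M + 1) ^ 2 ≤ E.η₀ * n + 2) :
    ∃ a : ℕ → ℤ, ∃ b : ℤ, E.faceLambda (tailF E.η₀ E.tail) n
      = (∑ s ∈ (Ioc 3 (M + 4)).filter Odd, (a s : ℝ) * zetaValue s) - (b : ℝ) := by
  have hη := E.two_tail_lt
  have hB : 3 ≤ M + 2 := by omega
  obtain ⟨c, hc⟩ := exists_laiTailData E.η₀ E.tail n hB hη
  have hc' := tailRQ_eq_pfEval E.η₀ E.tail n hη hc
  have hF := tailF_eq_coef hB hη hc'
  have h0 : tailCoef (E.η₀ * n) (tailDataOf E.η₀ E.tail n c) 0 = 0 := by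
    rw [tailCoef, tail_sum_order_zero hB hη hc', mul_zero]
  have hodd : ∀ o, o < M + 2 → Odd o → tailCoef (E.η₀ * n) (tailDataOf E.η₀ E.tail n c) o = 0 := by
    intro o ho hoo
    rw [tailCoef, tail_sum_vanish hB hη hc' o ho (((hMe.add even_two).mul_right _).add_odd hoo), mul_zero]
  have hA : ∀ o, ∃ z : ℤ, ((E.facePi n : ℕ) : ℚ) * tailCoef (E.η₀ * n) (tailDataOf E.η₀ E.tail n c) o
      / (E.facePhi n : ℚ) = (z : ℚ) := fun o =>
    E.exists_int_div_facePhi n (E.facePi_mul_tailCoef n hs hc o)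
      fun p hp => E.padicOrdGe_facePi_tailCoef n hs hn hc hp o
  choose za hza using hA
  obtain ⟨zb, hzb⟩ := E.exists_int_div_facePhi n (E.facePi_mul_tailConst n hs hc)
    fun p hp => E.padicOrdGe_facePi_tailConst n hs hn hc hp
  refine ⟨fun s => za (s - 3), zb, ?_⟩
  have hD : (E.faceD n : ℝ) = ((E.facePi n : ℕ) : ℝ) := by rw [E.faceD_eq_facePi]
  have eb : ((E.facePi n : ℕ) : ℝ) / (E.facePhi n : ℝ)
      * (tailConst (E.η₀ * n) (M + 2) (tailDataOf E.η₀ E.tail n c) : ℝ) = (zb : ℝ) := by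
    have := congrArg (fun q : ℚ => (q : ℝ)) hzb
    push_cast at this
    rw [← this]; ring
  have hw : ∑ o ∈ range (M + 2), ((((E.facePi n : ℕ) : ℚ) * tailCoef (E.η₀ * n) (tailDataOf E.η₀ E.tail n c) o
        / (E.facePhi n : ℚ) : ℚ) : ℝ) * zetaValue (o + 3)
      = ∑ s ∈ (Ioc 3 (M + 4)).filter Odd, ((((E.facePi n : ℕ) : ℚ)
          * tailCoef (E.η₀ * n) (tailDataOf E.η₀ E.tail n c) (s - 3) / (E.facePhi n : ℚ) : ℚ) : ℝ)
          * zetaValue s :=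
    sum_oddWindow_eq (fun o => ((E.facePi n : ℕ) : ℚ) * tailCoef (E.η₀ * n) (tailDataOf E.η₀ E.tail n c) o
        / (E.facePhi n : ℚ))
      (by rw [h0, mul_zero, zero_div]) (fun o ho hoo => by rw [hodd o ho hoo, mul_zero, zero_div])
  beta_reduce
  rw [faceLambda, hD, hF, mul_sub, eb, mul_sum]
  congr 1
  calc ∑ o ∈ range (M + 2), ((E.facePi n : ℕ) : ℝ) / (E.facePhi n : ℝ)
        * ((tailCoef (E.η₀ * n) (tailDataOf E.η₀ E.tail n c) o : ℝ) * zetaValue (o + 3))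
      = ∑ o ∈ range (M + 2), ((((E.facePi n : ℕ) : ℚ) * tailCoef (E.η₀ * n) (tailDataOf E.η₀ E.tail n c) o
          / (E.facePhi n : ℚ) : ℚ) : ℝ) * zetaValue (o + 3) := by
        refine sum_congr rfl fun o _ => ?_
        push_cast
        ring
    _ = _ := hw
    _ = ∑ s ∈ (Ioc 3 (M + 4)).filter Odd, (za (s - 3) : ℝ) * zetaValue s := by
        refine sum_congr rfl fun s _ => ?_
        rw [hza (s - 3)]
        norm_cast

/-- Kernel instance, `q = 9` (window `{ζ5, ζ7}`): the MODEL integral face direction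
`modelFace9Int = (93; 0³, 22, 25, 28, 31, 34, 37)` of fam-odd 5 — its growing normalised forms
`Λ_n = D_{71n}³D_{68n}D_{65n}D_{62n}D_{59n}D_{56n} · Φ(h_n)⁻¹ · F(h_n)` satisfy `Λ_n = a₅ζ(5) + a₇ζ(7) − b` with
`a₅, a₇, b ∈ ℤ` for every `n ≥ 1` ([Zudilin2004, Lemma 19]; fam-odd's `faceLambda_tailF_mem_ratSpan` had
`a₅, a₇, b ∈ ℚ`).  NOT evidence about `ζ(5)` or `ζ(7)`. -/
example (n : ℕ) (hn : 1 ≤ n) : ∃ a : ℕ → ℤ, ∃ b : ℤ,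
    modelFace9Int.faceLambda (tailF modelFace9Int.η₀ modelFace9Int.tail) n
      = (a 5 : ℝ) * zetaValue 5 + (a 7 : ℝ) * zetaValue 7 - (b : ℝ) := by
  obtain ⟨a, b, h⟩ := modelFace9Int.faceLambda_tailF_mem n (Fin.monotone_iff_le_succ.2 (by decide))
    (by norm_num) ⟨2, rfl⟩ (by show (4 + 1) ^ 2 ≤ 93 * n + 2; omega)
  refine ⟨a, b, ?_⟩
  rw [h, show (Ioc 3 (4 + 4)).filter Odd = {5, 7} by decide, sum_pair (by norm_num)]

end Summit.KontsevichZagierPeriods.Zeta5Search.WellPoisedFace.IntFaceDir
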